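import Mathlib.Analysis.Calculus.InverseFunctionTheorem.ContDiff
import Literature.Topology.FourManifolds.FibrewiseMorseFrame
import HarnessLib

/-!
# A periodic tube inverse function theorem

Helper `helper_foldNF_tubeIFT` of stub `helper_sliceGluing_foldNormalForm` (the `S¹`-parametric
fold normal form of the round circle), line `Sketch`, crux `SblfDescent.RungOne`.

(Crux item stmt-SmoothPoincare4-18531; skeleton `Cruxes/RungOne/Lines/Sketch.lean`.)

Let `F` be a real Banach space and `Ψ : ℝ × F → ℝ × F` a map which is `C^∞` on a uniform tube
`ℝ × B(0, r)`, fixes the zero section pointwise (`Ψ (t, 0) = (t, 0)`), is EQUIVARIANT under the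
translation by a period `T > 0` of the parameter (`Ψ (t + T, x) = Ψ (t, x) + (T, 0)` — so that
`Ψ` is the lift of a map of `S¹ × F` fixing the zero section), and has invertible differential at
every point of the zero section.  Then `Ψ` has a `C^∞` equivariant inverse `Φ` on a smaller
uniform tube `ℝ × B(0, ε)`: `Φ (t, 0) = (t, 0)`, `Φ (s + T, y) = Φ (s, y) + (T, 0)`,
`Φ (ℝ × B(0, ε)) ⊆ ℝ × B(0, r)` is open, `Ψ ∘ Φ = id` on the tube, and `dΦ` is invertible there.
This is the tubular-neighbourhood form of the inverse function theorem (Hirsch, *Differential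
Topology* (1976), Ch. 4 §5, proof of Thm. 5.1; Lang, *Differential and Riemannian Manifolds*,
IV §5) along the compact zero section `S¹ × {0}`, written on the universal cover with the period
`T` playing the role of compactness:

* the points where `dΨ` is invertible form an open periodic neighbourhood of `ℝ × {0}`, hence
  contain a uniform tube (`exists_ball_subset_of_forall_add`);
* `Ψ` is injective on a uniform tube: it is injective near each `(t, 0)` (inverse function
  theorem, Mathlib's `ContDiffAt.toOpenPartialHomeomorph`), uniformly for `t ∈ [0, T]`
  (Lebesgue number), the drift `(Ψ q).1 - q.1` is uniformly small on a tube, and two points with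
  the same image are brought into one injectivity ball by an integral translation;
* on that tube `Ψ` is an injective local diffeomorphism, so its image `V` is an open periodic
  neighbourhood of the zero section (containing a uniform tube `ℝ × B(0, ε)`) and the inverse
  `Φ = Ψ|ᵤ⁻¹` is `C^∞` with invertible differential (it agrees near each point with Mathlib's
  `localInverse`).

## References

* M. W. Hirsch, *Differential Topology*, GTM 33 (1976), Ch. 4 §5, Thm. 5.1. [HirschDT1976]
* S. Lang, *Fundamentals of Differential Geometry*, GTM 191 (1999), Ch. IV §5 (tubular
  neighbourhoods) and Ch. I §5 (inverse mapping theorem).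
-/

set_option linter.dupNamespace false

noncomputable section

open scoped Manifold ContDiff Topology
open Set Function Filter Metric Literature.Topology.FourManifolds

namespace Summit.SmoothPoincare4.SmoothPoincare4.Cruxes.RungOne.Sketch

/-- **Integral iterates of an equivariance.**  If `Ψ (t + T, x) = Ψ (t, x) + (T, 0)` for all
`t, x` then `Ψ (t + n T, x) = Ψ (t, x) + (n T, 0)` for every integer `n`. [folklore] -/
theorem apply_add_int_mul_of_equivariant {F : Type*} [AddCommGroup F] {Ψ : ℝ × F → ℝ × F}
    {T : ℝ} (hper : ∀ (t : ℝ) (x : F), Ψ (t + T, x) = Ψ (t, x) + (T, 0)) (n : ℤ) (t : ℝ)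
    (x : F) : Ψ (t + n * T, x) = Ψ (t, x) + (n * T, 0) := by
  induction n using Int.induction_on generalizing t with
  | zero => simp
  | succ n ih =>
    have h1 : t + ((n : ℤ) + 1 : ℤ) * T = (t + (n : ℤ) * T) + T := by push_cast; ring
    have h2 : (((n : ℤ) * T, (0 : F)) : ℝ × F) + (T, 0) = (((n : ℤ) + 1 : ℤ) * T, 0) := by
      ext <;> simp; ring
    rw [h1, hper, ih, add_assoc, h2]
  | pred n ih =>
    have h1 : t + (-(n : ℤ) : ℤ) * T = (t + (-(n : ℤ) - 1 : ℤ) * T) + T := by push_cast; ring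
    have h2 : (((-(n : ℤ) : ℤ) : ℝ) * T, (0 : F)) = (((-(n : ℤ) - 1 : ℤ) : ℝ) * T, (0 : F)) + (T, 0) := by
      ext <;> simp; ring
    have key := ih t
    rw [h1, hper, h2, ← add_assoc] at key
    exact add_right_cancel key

/-- **Local inverses near the zero section.**  `Ψ : ℝ × F → ℝ × F`, `C^∞` on an open set `U`
on which it is injective and has invertible differential: then `V = Ψ '' U` is open and the
inverse `Φ = (Ψ|ᵤ)⁻¹` (`Function.invFunOn Ψ U`) is `C^∞` with invertible differential at every
point of `V` — it agrees near `Ψ p` with Mathlib's `localInverse` of `Ψ` at `p` (inverse function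
theorem). [folklore] -/
theorem invFunOn_contDiffAt_of_injOn {E : Type*} [NormedAddCommGroup E] [NormedSpace ℝ E]
    [CompleteSpace E] {Ψ : E → E} {U : Set E} (hU : IsOpen U) (hΨ : ContDiffOn ℝ ∞ Ψ U)
    (hinj : InjOn Ψ U) (hinv : ∀ q ∈ U, (fderiv ℝ Ψ q).IsInvertible) [Nonempty E] :
    IsOpen (Ψ '' U) ∧ ∀ p ∈ U, ContDiffAt ℝ ∞ (invFunOn Ψ U) (Ψ p) ∧
      (fderiv ℝ (invFunOn Ψ U) (Ψ p)).IsInvertible := by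
  set Φ : E → E := invFunOn Ψ U with hΦ
  have hleft : ∀ p ∈ U, Φ (Ψ p) = p := fun p hp => hinj.leftInvOn_invFunOn hp
  -- the local inverse at `p ∈ U`
  have hdata : ∀ p ∈ U, ∃ L : E ≃L[ℝ] E, ContDiffAt ℝ ∞ Ψ p ∧ HasFDerivAt Ψ (L : E →L[ℝ] E) p :=
      fun p hp => by
    obtain ⟨L, hL⟩ := hinv p hp
    have hc : ContDiffAt ℝ ∞ Ψ p := hΨ.contDiffAt (hU.mem_nhds hp)
    exact ⟨L, hc, hL ▸ (hc.differentiableAt (by simp)).hasFDerivAt⟩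
  have hev : ∀ p ∈ U, ∀ᶠ x in 𝓝 p, Φ (Ψ x) = x := fun p hp =>
    Filter.eventually_of_mem (hU.mem_nhds hp) hleft
  refine ⟨?_, fun p hp => ?_⟩
  · refine isOpen_iff_mem_nhds.2 ?_
    rintro _ ⟨p, hp, rfl⟩
    obtain ⟨L, hc, hd⟩ := hdata p hp
    have hs := hc.hasStrictFDerivAt' hd (by simp)
    have h1 := hs.eventually_right_inverse
    have h2 : ∀ᶠ y in 𝓝 (Ψ p), hs.localInverse Ψ L p y ∈ U :=
      hs.localInverse_tendsto (hU.mem_nhds hp)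
    filter_upwards [h1, h2] with y hy1 hy2
    exact ⟨_, hy2, hy1⟩
  · obtain ⟨L, hc, hd⟩ := hdata p hp
    have hs := hc.hasStrictFDerivAt' hd (by simp)
    have huniq : ∀ᶠ y in 𝓝 (Ψ p), Φ y = hs.localInverse Ψ L p y := hs.localInverse_unique (hev p hp)
    refine ⟨?_, ?_⟩
    · have h := hc.to_localInverse hd (by simp)
      exact h.congr_of_eventuallyEq huniq
    · have h := hs.to_local_left_inverse (hev p hp)
      rw [h.hasFDerivAt.fderiv]
      exact ⟨L.symm, rfl⟩

/-- **Uniform injectivity on a tube, periodic version.**  `Ψ : ℝ × F → ℝ × F` continuous on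
`ℝ × B(0, r)`, fixing the zero section, `T`-equivariant (`T > 0`), and injective near every
point of the zero section: then `Ψ` is injective on a uniform tube `ℝ × B(0, ρ)`, `0 < ρ ≤ r`
(Lebesgue number over the period `[0, T] × {0}`, a uniform bound on the drift `(Ψ q).1 - q.1`,
and an integral translation; Hirsch 1976, Ch. 4, proof of Thm. 5.1). [folklore] -/
theorem exists_injOn_tube_of_equivariant {F : Type*} [NormedAddCommGroup F] [NormedSpace ℝ F]
    {Ψ : ℝ × F → ℝ × F} {r T : ℝ} (hr : 0 < r) (hT : 0 < T)
    (hΨ : ContinuousOn Ψ (univ ×ˢ ball (0 : F) r)) (h0 : ∀ t : ℝ, Ψ (t, 0) = (t, 0))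
    (hper : ∀ (t : ℝ) (x : F), Ψ (t + T, x) = Ψ (t, x) + (T, 0))
    (hloc : ∀ t : ℝ, ∃ U : Set (ℝ × F), IsOpen U ∧ ((t, (0 : F)) : ℝ × F) ∈ U ∧ InjOn Ψ U) :
    ∃ ρ : ℝ, 0 < ρ ∧ ρ ≤ r ∧ InjOn Ψ (univ ×ˢ ball (0 : F) ρ) := by
  have hSo : IsOpen ((univ : Set ℝ) ×ˢ ball (0 : F) r) := isOpen_univ.prod isOpen_ball
  -- a Lebesgue number for the injectivity neighbourhoods over one period
  choose U hUo hUmem hUinj using hloc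
  obtain ⟨δ, hδ, hδU⟩ : ∃ δ > 0, ∀ t ∈ Icc (0 : ℝ) T, InjOn Ψ (ball ((t, (0 : F)) : ℝ × F) δ) := by
    have hK : IsCompact (Icc (0 : ℝ) T ×ˢ ({0} : Set F)) := isCompact_Icc.prod isCompact_singleton
    have hcov : Icc (0 : ℝ) T ×ˢ ({0} : Set F) ⊆ ⋃ t : ℝ, U t := by
      rintro ⟨t, x⟩ ⟨-, hx⟩
      rw [mem_singleton_iff] at hx
      subst hx
      exact mem_iUnion.2 ⟨t, hUmem t⟩
    obtain ⟨δ, hδ, hball⟩ := lebesgue_number_lemma_of_metric hK hUo hcov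
    refine ⟨δ, hδ, fun t ht => ?_⟩
    obtain ⟨i, hi⟩ := hball (t, 0) ⟨ht, rfl⟩
    exact (hUinj i).mono hi
  -- a uniform bound on the drift `(Ψ q).1 - q.1`
  obtain ⟨r₂, hr₂, hdrift⟩ : ∃ r₂ > 0, ∀ (t : ℝ) (x : F), x ∈ ball (0 : F) r₂ →
      x ∈ ball (0 : F) r ∧ dist (Ψ (t, x)).1 t < δ / 2 := by
    set W : Set (ℝ × F) := {q | q ∈ (univ : Set ℝ) ×ˢ ball (0 : F) r ∧ dist (Ψ q).1 q.1 < δ / 2}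
      with hW
    have hWo : IsOpen W := by
      have hc : ContinuousOn (fun q : ℝ × F => dist (Ψ q).1 q.1) ((univ : Set ℝ) ×ˢ ball (0 : F) r) :=
        continuous_dist.comp_continuousOn
          ((continuous_fst.comp_continuousOn hΨ).prodMk continuous_fst.continuousOn)
      have := hc.isOpen_inter_preimage hSo (isOpen_Iio (a := δ / 2))
      convert this using 1
      ext q
      simp [hW]
    have hW0 : ∀ t : ℝ, ((t, (0 : F)) : ℝ × F) ∈ W := fun t =>
      ⟨⟨mem_univ _, mem_ball_self hr⟩, by simp [h0, hδ]⟩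
    have hW1 : ∀ (t : ℝ) (u : F), ((t, u) : ℝ × F) ∈ W → ((t + T, u) : ℝ × F) ∈ W := by
      rintro t u ⟨⟨-, hu⟩, hd⟩
      refine ⟨⟨mem_univ _, hu⟩, ?_⟩
      simpa [hper, Real.dist_eq] using hd
    have hW2 : ∀ (t : ℝ) (u : F), ((t, u) : ℝ × F) ∈ W → ((t - T, u) : ℝ × F) ∈ W := by
      rintro t u ⟨⟨-, hu⟩, hd⟩
      refine ⟨⟨mem_univ _, hu⟩, ?_⟩
      have := hper (t - T) u
      rw [sub_add_cancel] at this
      rw [this] at hd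
      simpa [Real.dist_eq] using hd
    obtain ⟨r₂, hr₂, hball⟩ := exists_ball_subset_of_forall_add hWo hW0 hT hW1 hW2
    exact ⟨r₂, hr₂, fun t x hx => ⟨(hball t x hx).1.2, (hball t x hx).2⟩⟩
  -- the tube radius
  refine ⟨min (min r r₂) (δ / 2), lt_min (lt_min hr hr₂) (half_pos hδ),
    (min_le_left _ _).trans (min_le_left _ _), ?_⟩
  rintro ⟨t, x⟩ ⟨-, hx⟩ ⟨t', x'⟩ ⟨-, hx'⟩ heq
  rw [mem_ball, dist_zero_right] at hx hx'
  have hx2 : x ∈ ball (0 : F) r₂ := by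
    rw [mem_ball, dist_zero_right]; exact hx.trans_le ((min_le_left _ _).trans (min_le_right _ _))
  have hx2' : x' ∈ ball (0 : F) r₂ := by
    rw [mem_ball, dist_zero_right]; exact hx'.trans_le ((min_le_left _ _).trans (min_le_right _ _))
  have hxδ : ‖x‖ < δ / 2 := hx.trans_le (min_le_right _ _)
  have hxδ' : ‖x'‖ < δ / 2 := hx'.trans_le (min_le_right _ _)
  -- the parameters are `δ`-close
  have htt : dist t' t < δ := by
    have h1 := (hdrift t x hx2).2
    have h2 := (hdrift t' x' hx2').2
    have h3 : (Ψ (t, x)).1 = (Ψ (t', x')).1 := by rw [heq]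
    calc dist t' t ≤ dist t' (Ψ (t', x')).1 + dist (Ψ (t', x')).1 t := dist_triangle _ _ _
      _ = dist (Ψ (t', x')).1 t' + dist (Ψ (t, x)).1 t := by rw [dist_comm, h3]
      _ < δ / 2 + δ / 2 := add_lt_add h2 h1
      _ = δ := by ring
  -- translate into one period
  set k : ℤ := toIcoDiv hT 0 t with hk
  set t₀ : ℝ := toIcoMod hT 0 t with ht₀
  have ht₀mem : t₀ ∈ Icc (0 : ℝ) T := Ico_subset_Icc_self (by simpa [ht₀] using toIcoMod_mem_Ico hT 0 t)
  have htk : t = t₀ + k * T := by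
    rw [ht₀, hk, toIcoMod, zsmul_eq_mul]; ring
  have hP : Ψ (t₀, x) = Ψ (t' - k * T, x') := by
    have e1 := apply_add_int_mul_of_equivariant hper k t₀ x
    have e2 := apply_add_int_mul_of_equivariant hper k (t' - k * T) x'
    rw [← htk] at e1
    rw [sub_add_cancel] at e2
    have : Ψ (t₀, x) + ((k : ℝ) * T, 0) = Ψ (t' - k * T, x') + ((k : ℝ) * T, 0) := by
      rw [← e1, ← e2, heq]
    exact add_right_cancel this
  have hm1 : ((t₀, x) : ℝ × F) ∈ ball ((t₀, (0 : F)) : ℝ × F) δ := by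
    rw [mem_ball, Prod.dist_eq, dist_self, dist_zero_right]
    exact max_lt hδ (by linarith)
  have hm2 : ((t' - k * T, x') : ℝ × F) ∈ ball ((t₀, (0 : F)) : ℝ × F) δ := by
    rw [mem_ball, Prod.dist_eq, dist_zero_right]
    refine max_lt ?_ (by linarith)
    have : dist (t' - k * T) t₀ = dist t' t := by
      rw [Real.dist_eq, Real.dist_eq, htk]; ring_nf
    rw [this]; exact htt
  have key := hδU t₀ ht₀mem hm1 hm2 hP
  obtain ⟨h1, h2⟩ := Prod.mk.inj key
  have htt' : t = t' := by rw [htk, h1, sub_add_cancel]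
  rw [htt', h2]

/-- **Periodic tube inverse function theorem.**  Let `F` be a real Banach space, `r, T > 0`,
and `Ψ : ℝ × F → ℝ × F` be `C^∞` on the tube `ℝ × B(0, r)`, with `Ψ (t, 0) = (t, 0)`,
`Ψ (t + T, x) = Ψ (t, x) + (T, 0)` and `dΨ (t, 0)` invertible for all `t`.  Then there are
`ε > 0` and `Φ : ℝ × F → ℝ × F`, `C^∞` on `ℝ × B(0, ε)`, with `Φ (t, 0) = (t, 0)`,
`Φ (s + T, y) = Φ (s, y) + (T, 0)` (`‖y‖ < ε`), `Φ (ℝ × B(0, ε)) ⊆ ℝ × B(0, r)`, `Ψ ∘ Φ = id`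
and `dΦ` invertible on `ℝ × B(0, ε)`, and `Φ (ℝ × B(0, ε))` open.  (Inverse function theorem
along the zero section: Hirsch 1976, Ch. 4 §5, proof of Thm. 5.1, on the universal cover of
`S¹ × F`.) [cite: HirschDT1976, Ch. 4 §5, Thm. 5.1] -/
theorem helper_foldNF_tubeIFT : ∀ (F : Type) [NormedAddCommGroup F] [NormedSpace ℝ F] [CompleteSpace F] (Ψ : ℝ × F → ℝ × F) (r T : ℝ), 0 < r → 0 < T → ContDiffOn ℝ ∞ Ψ (Set.univ ×ˢ Metric.ball 0 r) → (∀ t : ℝ, Ψ (t, 0) = (t, 0)) → (∀ (t : ℝ) (x : F), Ψ (t + T, x) = Ψ (t, x) + (T, 0)) → (∀ t : ℝ, (fderiv ℝ Ψ (t, 0)).IsInvertible) → ∃ (ε : ℝ) (Φ : ℝ × F → ℝ × F), 0 < ε ∧ ContDiffOn ℝ ∞ Φ (Set.univ ×ˢ Metric.ball 0 ε) ∧ (∀ t : ℝ, Φ (t, 0) = (t, 0)) ∧ (∀ (s : ℝ) (y : F), y ∈ Metric.ball (0 : F) ε → Φ (s + T, y) = Φ (s, y) + (T, 0)) ∧ (∀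 q ∈ Set.univ ×ˢ Metric.ball (0 : F) ε, Φ q ∈ Set.univ ×ˢ Metric.ball (0 : F) r ∧ Ψ (Φ q) = q) ∧ (∀ q ∈ Set.univ ×ˢ Metric.ball (0 : F) ε, (fderiv ℝ Φ q).IsInvertible) ∧ IsOpen (Φ '' (Set.univ ×ˢ Metric.ball (0 : F) ε)) := by
  intro F _ _ _ Ψ r T hr hT hΨ h0 hper hinv
  have hSo : ∀ ρ : ℝ, IsOpen ((univ : Set ℝ) ×ˢ ball (0 : F) ρ) := fun ρ => isOpen_univ.prod isOpen_ball
  have hmemS : ∀ {ρ : ℝ} {t : ℝ} {x : F}, ((t, x) : ℝ × F) ∈ (univ : Set ℝ) ×ˢ ball (0 : F) ρ ↔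
      x ∈ ball (0 : F) ρ := fun {ρ t x} => by simp
  have hΨat : ∀ q ∈ (univ : Set ℝ) ×ˢ ball (0 : F) r, ContDiffAt ℝ ∞ Ψ q := fun q hq =>
    hΨ.contDiffAt ((hSo r).mem_nhds hq)
  -- equivariance of the differential
  have hfdper : ∀ q : ℝ × F, fderiv ℝ Ψ (q + (T, 0)) = fderiv ℝ Ψ q := fun q => by
    have hfun : (fun p => Ψ (p + (T, 0))) = fun p => Ψ p + (T, 0) := by
      funext p
      obtain ⟨t, x⟩ := p
      rw [Prod.mk_add_mk, add_zero, hper]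
    have h1 : fderiv ℝ (fun p => Ψ (p + (T, 0))) q = fderiv ℝ Ψ (q + (T, 0)) :=
      fderiv_comp_add_right (T, 0)
    rw [← h1, hfun, fderiv_add_const]
  -- Step 1: `dΨ` is invertible on a uniform tube
  obtain ⟨r₁, hr₁, hr₁r, hinv₁⟩ : ∃ r₁ : ℝ, 0 < r₁ ∧ r₁ ≤ r ∧
      ∀ q ∈ (univ : Set ℝ) ×ˢ ball (0 : F) r₁, (fderiv ℝ Ψ q).IsInvertible := by
    set W : Set (ℝ × F) := (univ : Set ℝ) ×ˢ ball (0 : F) r ∩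
      fderiv ℝ Ψ ⁻¹' range ((↑) : ((ℝ × F) ≃L[ℝ] (ℝ × F)) → (ℝ × F) →L[ℝ] (ℝ × F)) with hW
    have hWo : IsOpen W :=
      (hΨ.continuousOn_fderiv_of_isOpen (hSo r) (by simp)).isOpen_inter_preimage (hSo r)
        ContinuousLinearEquiv.isOpen
    have hW0 : ∀ t : ℝ, ((t, (0 : F)) : ℝ × F) ∈ W := fun t =>
      ⟨hmemS.2 (mem_ball_self hr), hinv t⟩
    have hW1 : ∀ (t : ℝ) (u : F), ((t, u) : ℝ × F) ∈ W → ((t + T, u) : ℝ × F) ∈ W := by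
      rintro t u ⟨h1, h2⟩
      refine ⟨hmemS.2 (hmemS.1 h1), ?_⟩
      have e : ((t + T, u) : ℝ × F) = (t, u) + (T, 0) := by simp
      rw [mem_preimage, e, hfdper]
      exact h2
    have hW2 : ∀ (t : ℝ) (u : F), ((t, u) : ℝ × F) ∈ W → ((t - T, u) : ℝ × F) ∈ W := by
      rintro t u ⟨h1, h2⟩
      refine ⟨hmemS.2 (hmemS.1 h1), ?_⟩
      have e : ((t, u) : ℝ × F) = (t - T, u) + (T, 0) := by simp
      rw [mem_preimage, ← hfdper, ← e]
      exact h2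
    obtain ⟨r₁, hr₁, hball⟩ := exists_ball_subset_of_forall_add hWo hW0 hT hW1 hW2
    refine ⟨min r₁ r, lt_min hr₁ hr, min_le_right _ _, ?_⟩
    rintro ⟨t, x⟩ hq
    have hx : x ∈ ball (0 : F) r₁ := ball_subset_ball (min_le_left _ _) (hmemS.1 hq)
    exact (hball t x hx).2
  -- Step 2: `Ψ` is injective on a uniform tube
  obtain ⟨r₂, hr₂, hr₂r, hinj₂⟩ : ∃ r₂ : ℝ, 0 < r₂ ∧ r₂ ≤ r ∧
      InjOn Ψ ((univ : Set ℝ) ×ˢ ball (0 : F) r₂) := by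
    refine exists_injOn_tube_of_equivariant hr hT hΨ.continuousOn h0 hper fun t => ?_
    obtain ⟨L, hL⟩ := hinv t
    have hc : ContDiffAt ℝ ∞ Ψ (t, 0) := hΨat _ (hmemS.2 (mem_ball_self hr))
    have hd : HasFDerivAt Ψ (L : (ℝ × F) →L[ℝ] (ℝ × F)) (t, 0) :=
      hL ▸ (hc.differentiableAt (by simp)).hasFDerivAt
    set e := hc.toOpenPartialHomeomorph Ψ hd (by simp) with he
    exact ⟨e.source, e.open_source, hc.mem_toOpenPartialHomeomorph_source hd (by simp), e.injOn⟩
  -- Step 3: the injective local diffeomorphism `Ψ|ᵤ`, `U = ℝ × B(0, r₃)`, and its inverse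
  set r₃ : ℝ := min r₁ r₂ with hr₃
  have hr₃pos : 0 < r₃ := lt_min hr₁ hr₂
  set U : Set (ℝ × F) := (univ : Set ℝ) ×ˢ ball (0 : F) r₃ with hU
  have hUr : U ⊆ (univ : Set ℝ) ×ˢ ball (0 : F) r := fun q hq =>
    hmemS.2 (ball_subset_ball ((min_le_left _ _).trans hr₁r) (hmemS.1 hq))
  have hU₁ : U ⊆ (univ : Set ℝ) ×ˢ ball (0 : F) r₁ := fun q hq =>
    hmemS.2 (ball_subset_ball (min_le_left _ _) (hmemS.1 hq))
  have hU₂ : U ⊆ (univ : Set ℝ) ×ˢ ball (0 : F) r₂ := fun q hq =>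
    hmemS.2 (ball_subset_ball (min_le_right _ _) (hmemS.1 hq))
  have hUo : IsOpen U := hSo r₃
  have hΨU : ContDiffOn ℝ ∞ Ψ U := hΨ.mono hUr
  have hinjU : InjOn Ψ U := hinj₂.mono hU₂
  have hinvU : ∀ q ∈ U, (fderiv ℝ Ψ q).IsInvertible := fun q hq => hinv₁ q (hU₁ hq)
  have hUT : ∀ q ∈ U, q + (T, 0) ∈ U := by
    rintro ⟨t, x⟩ hq
    rw [Prod.mk_add_mk, add_zero]
    exact hmemS.2 (hmemS.1 hq)
  have hUT' : ∀ q ∈ U, q - (T, 0) ∈ U := by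
    rintro ⟨t, x⟩ hq
    rw [Prod.mk_sub_mk, sub_zero]
    exact hmemS.2 (hmemS.1 hq)
  set Φ : ℝ × F → ℝ × F := invFunOn Ψ U with hΦ
  obtain ⟨hVo, hΦat⟩ := invFunOn_contDiffAt_of_injOn hUo hΨU hinjU hinvU
  have hleft : ∀ p ∈ U, Φ (Ψ p) = p := fun p hp => hinjU.leftInvOn_invFunOn hp
  have hright : ∀ b ∈ Ψ '' U, Φ b ∈ U ∧ Ψ (Φ b) = b := fun b hb => by
    obtain ⟨a, ha, rfl⟩ := hb
    exact invFunOn_pos ⟨a, ha, rfl⟩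
  -- the image `V = Ψ '' U` is an open periodic neighbourhood of the zero section
  have hV0 : ∀ t : ℝ, ((t, (0 : F)) : ℝ × F) ∈ Ψ '' U := fun t =>
    ⟨(t, 0), hmemS.2 (mem_ball_self hr₃pos), h0 t⟩
  have hV1 : ∀ (t : ℝ) (u : F), ((t, u) : ℝ × F) ∈ Ψ '' U → ((t + T, u) : ℝ × F) ∈ Ψ '' U := by
    rintro t u ⟨p, hp, hpq⟩
    refine ⟨p + (T, 0), hUT p hp, ?_⟩
    obtain ⟨a, b⟩ := p
    rw [Prod.mk_add_mk, add_zero, hper, hpq, Prod.mk_add_mk, add_zero]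
  have hV2 : ∀ (t : ℝ) (u : F), ((t, u) : ℝ × F) ∈ Ψ '' U → ((t - T, u) : ℝ × F) ∈ Ψ '' U := by
    rintro t u ⟨p, hp, hpq⟩
    refine ⟨p - (T, 0), hUT' p hp, ?_⟩
    obtain ⟨a, b⟩ := p
    have := hper (a - T) b
    rw [sub_add_cancel] at this
    rw [Prod.mk_sub_mk, sub_zero, ← sub_eq_iff_eq_add.2 this, hpq, Prod.mk_sub_mk, sub_zero]
  obtain ⟨ε, hε, hεV⟩ := exists_ball_subset_of_forall_add hVo hV0 hT hV1 hV2
  have hSV : (univ : Set ℝ) ×ˢ ball (0 : F) ε ⊆ Ψ '' U := by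
    rintro ⟨s, y⟩ hq
    exact hεV s y (hmemS.1 hq)
  -- conclusion
  refine ⟨ε, Φ, hε, ?_, fun t => ?_, fun s y hy => ?_, fun q hq => ?_, fun q hq => ?_, ?_⟩
  · -- smoothness on the tube
    intro q hq
    obtain ⟨p, hp, rfl⟩ := hSV hq
    exact (hΦat p hp).1.contDiffWithinAt
  · -- zero section
    have := hleft (t, 0) (hmemS.2 (mem_ball_self hr₃pos))
    rwa [h0] at this
  · -- equivariance
    have hq : ((s, y) : ℝ × F) ∈ Ψ '' U := hSV (hmemS.2 hy)
    obtain ⟨h1, h2⟩ := hright _ hq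
    have h3 : Ψ (Φ (s, y) + (T, 0)) = (s + T, y) := by
      have e := hper (Φ (s, y)).1 (Φ (s, y)).2
      rw [Prod.mk.eta] at e
      rw [show Φ (s, y) + (T, 0) = ((Φ (s, y)).1 + T, (Φ (s, y)).2) by
        ext <;> simp, e, h2, Prod.mk_add_mk, add_zero]
    have := hleft _ (hUT _ h1)
    rw [h3] at this
    exact this
  · -- `Φ` maps the tube into `ℝ × B(0, r)` and is a right inverse of `Ψ`
    obtain ⟨h1, h2⟩ := hright q (hSV hq)
    exact ⟨hUr h1, h2⟩
  · -- `dΦ` is invertible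
    obtain ⟨p, hp, rfl⟩ := hSV hq
    exact (hΦat p hp).2
  · -- the image of the tube is open: it is `U ∩ Ψ ⁻¹' (ℝ × B(0, ε))`
    have heq : Φ '' ((univ : Set ℝ) ×ˢ ball (0 : F) ε) = U ∩ Ψ ⁻¹' ((univ : Set ℝ) ×ˢ ball (0 : F) ε) := by
      refine subset_antisymm ?_ ?_
      · rintro _ ⟨q, hq, rfl⟩
        obtain ⟨h1, h2⟩ := hright q (hSV hq)
        exact ⟨h1, by rw [mem_preimage, h2]; exact hq⟩
      · rintro p ⟨hp, hpε⟩
        exact ⟨Ψ p, hpε, hleft p hp⟩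
    rw [heq]
    exact hΨU.continuousOn.isOpen_inter_preimage hUo (hSo ε)

end Summit.SmoothPoincare4.SmoothPoincare4.Cruxes.RungOne.Sketch

end
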